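import Mathlib.Geometry.Manifold.IntegralCurve.UniformTime
import Mathlib.Analysis.SpecialFunctions.ExpDeriv
import Mathlib.Topology.Order.MonotoneConvergence
import Literature.Topology.FourManifolds.HandleSpheres
import Literature.Topology.FourManifolds.FlowHittingTime
import Literature.Topology.FourManifolds.GradientLikeExistence
import Literature.Topology.FourManifolds.ProductCobordismFlow
import Literature.Topology.FourManifolds.SPC4HandleChainProofs
import HarnessLib

/-!
# Dynamics of (cut-off) gradient-like flows: points that never climb above a level are
# caught by the stable discs of the critical points

Topic `Literature/Topology/FourManifolds` (fact seat
`provefact-Literature.SPC4.exists_diffeomorph_comp_incl_eq`, leaf C "the boundary of a `4`-dimensional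
`1`-handlebody is connected", assembled in `OneHandlebodyBoundary.lean`).  Everything here is
**proved**.

**Setting.**  `M` a Hausdorff `C^∞` manifold (model with corners `J` on `ℝᵐ`), `f : M → ℝ`
smooth, `X` a smooth vector field with a **global flow** `θ : ℝ × M → M`
(`Literature.IsFlowOf X θ`: continuous, `θ(0, p) = p`, `θ(t, θ(s, p)) = θ(t + s, p)`, curves =
integral curves; e.g. from `CompleteFlow.lean`), such that `X(f) ≥ 0` everywhere — think of
`X = ρ • ξ` with `ξ` gradient-like for a Morse function `f` (Milnor, *Lectures on the
h-cobordism theorem* (1965), Def. 3.1) and `ρ` a cut-off equal to `1` on `{f ≤ a'}`.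

**Results.**
* `IsFlowOf.monotone_apply`: `t ↦ f(θ(t, p))` is monotone; `apply_lt_apply_of_pos`: strictly
  past a time where `X(f) > 0` (Milnor, proof of Thm. 3.4: `d/dt f(φ(t)) = ξ(f)`).
* `IsFlowOf.isOpen_escapeSet`: the set of points whose forward orbit climbs above the level
  `a` is open.
* `IsFlowOf.exists_isMCriticalPt_mapClusterPt` (**ω-limit points are critical**): if the
  forward orbit of `p` stays in `{f ≤ a}`, where `X(f) > 0` off the critical set, then on a
  compact `M` the orbit `t ↦ θ(t, p)` has a cluster point as `t → ∞`, which is a critical point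
  `q` with `f q = sup_t f(θ(t, p))` (elementary Lyapunov argument).
* **The trap lemma** `Literature.Topology.FourManifolds.MilnorBox.sqSumGE_coord_eq_zero` (`Literature.MilnorBox J f X q`: a chart
  about a critical point `q` in which `f = f(q) - |x⃗|² + |y⃗|²` and `X = (-x⃗, y⃗)`, Milnor's
  normal form of Def. 3.1 (2), with a box `{|x⃗|² < ε², |y⃗|² < 4ε²}` inside its domain): an
  orbit that is in the box at time `t₁` and satisfies `f(θ(t, p)) ≤ f(q)` for all `t ≥ t₁` has
  `y⃗(θ(t₁, p)) = 0`: otherwise `d|y⃗|²/dt = 2|y⃗|²` and `d|x⃗|²/dt = -2|x⃗|² ≤ 0` as long as the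
  orbit stays in the box (the model integral curves are `(x⃗ e^{-t}, y⃗ e^{t})`, as in the
  explicit local computations of Milnor's proof of Thm. 5.4, PDF p. 28), so it leaves the box
  through `|y⃗|² = 4ε²`, where `f ≥ f(q) - ε² + 4ε² > f(q)`.
* `IsFlowOf.exists_mem_stableDisc` (**consequence**): under the hypotheses of
  `exists_isMCriticalPt_mapClusterPt`, with `X` in Milnor normal form of index `k` near the limit
  critical point `q`, the point `p` is `θ(-t₁, d)` for some `t₁ ≥ 0` and some `d` on the local
  **stable disc** `{y⃗ = 0, |x⃗| < ε}` of `q`.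

These are the ingredients of the deformation "`V ∖ ⋃ W^s(p)` flows up to `∂V`" in
`OneHandlebodyBoundary.lean`.

## References

* J. Milnor, *Lectures on the h-cobordism theorem*, Princeton (1965), Def. 3.1, proof of
  Thm. 3.4 (`df(φ(t))/dt = ξ(f)`), Def. 3.9 (the left-hand disc: union of the integral curves
  ending at `p`), proofs of Thm. 3.13 and Thm. 5.4 (integral curves in Milnor coordinates).
  [MilnorHCobordism1965]
* J. M. Lee, *Introduction to Smooth Manifolds*, 2nd ed. (2012), Ch. 9, (9.2)–(9.3),
  Thm. 9.12 (flows). [LeeSmoothManifolds2013]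
-/

open scoped Manifold ContDiff Topology
open Set Function Filter Metric

noncomputable section

namespace Literature.Topology.FourManifolds

universe u

/-! ### Global flows of a vector field -/

section Flow

variable {E : Type*} [NormedAddCommGroup E] [NormedSpace ℝ E] {H : Type*} [TopologicalSpace H]
  {I : ModelWithCorners ℝ E H} {M : Type u} [TopologicalSpace M] [ChartedSpace H M]

variable (I) in
/-- **A global flow of the vector field `X`**: a continuous `θ : ℝ × M → M` with
`θ(0, p) = p`, `θ(t, θ(s, p)) = θ(t + s, p)`, whose curves `t ↦ θ(t, p)` are integral curves
of `X` (Lee, *Introduction to Smooth Manifolds* (2012), Ch. 9, (9.2) and Thm. 9.12; the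
conclusion of the tree's `Literature.Topology.FourManifolds.exists_contMDiff_globalFlow`, minus smoothness).  This is the
topological part of the tree's `Literature.Topology.FourManifolds.IsSmoothFlow` (`FlowHittingTime.lean`, jointly `C^∞`
flows; `Literature.Topology.FourManifolds.IsSmoothFlow.isFlowOf`): the dynamics below (monotonicity of `f` along the flow,
cluster points, the trap lemma) only uses continuity of `θ`. [cite: LeeSmoothManifolds2013, Ch. 9, (9.2)–(9.3) and Thm. 9.12] -/
structure IsFlowOf (X : Π x : M, TangentSpace I x) (θ : ℝ × M → M) : Prop where
  /-- The flow is continuous jointly in time and position. -/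
  continuous : Continuous θ
  /-- Time zero is the identity. -/
  map_zero : ∀ p, θ (0, p) = p
  /-- The group law. -/
  map_add : ∀ t s p, θ (t, θ (s, p)) = θ (t + s, p)
  /-- The curves of the flow are integral curves of `X`. -/
  isMIntegralCurve : ∀ p, IsMIntegralCurve (fun t => θ (t, p)) X

namespace IsFlowOf

variable {X : Π x : M, TangentSpace I x} {θ : ℝ × M → M}

/-- A smooth global flow (`Literature.Topology.FourManifolds.IsSmoothFlow`, `FlowHittingTime.lean`) is a flow. [cite: LeeSmoothManifolds2013, Ch. 9, (9.2)–(9.3) and Thm. 9.12] -/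
theorem _root_.Literature.Topology.FourManifolds.IsSmoothFlow.isFlowOf (h : IsSmoothFlow I X θ) : IsFlowOf I X θ :=
  ⟨h.continuous, h.map_zero, h.map_add, h.isMIntegralCurve⟩

/-- `θ(-t, θ(t, p)) = p` (for smooth flows this is `Literature.Topology.FourManifolds.IsSmoothFlow.apply_neg_apply`). [cite: LeeSmoothManifolds2013, Ch. 9, (9.2)–(9.3)] -/
theorem map_neg_map (h : IsFlowOf I X θ) (t : ℝ) (p : M) : θ (-t, θ (t, p)) = p := by
  rw [h.map_add, neg_add_cancel, h.map_zero]

/-- `θ(t, θ(-t, p)) = p`. [cite: LeeSmoothManifolds2013, Ch. 9, (9.2)–(9.3)] -/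
theorem map_map_neg (h : IsFlowOf I X θ) (t : ℝ) (p : M) : θ (t, θ (-t, p)) = p := by
  rw [h.map_add, add_neg_cancel, h.map_zero]

/-- The time-`t` map is continuous. [folklore] -/
theorem continuous_apply (h : IsFlowOf I X θ) (t : ℝ) : Continuous fun p => θ (t, p) :=
  h.continuous.comp (Continuous.prodMk_right t)

/-- Each orbit is continuous. [folklore] -/
theorem continuous_orbit (h : IsFlowOf I X θ) (p : M) : Continuous fun t => θ (t, p) :=
  h.continuous.comp (Continuous.prodMk_left p)

/-- **A zero of the field is a fixed point of the flow** (uniqueness of integral curves on a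
Hausdorff manifold with corners, the tree's `Literature.Topology.FourManifolds.IsMIntegralCurveOn.eqOn_Icc`). [folklore] -/
theorem apply_eq_self_of_apply_eq_zero [IsManifold I ∞ M] [T2Space M] (h : IsFlowOf I X θ)
    (hX : ContMDiff I I.tangent ∞ fun x => (⟨x, X x⟩ : TangentBundle I M)) {q : M}
    (hq : X q = 0) (t : ℝ) : θ (t, q) = q := by
  have h₁ : IsMIntegralCurveOn (fun t => θ (t, q)) X (Icc (min t 0) (max t 0)) :=
    (h.isMIntegralCurve q).isMIntegralCurveOn _
  have h₂ : IsMIntegralCurveOn (fun _ => q) X (Icc (min t 0) (max t 0)) :=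
    (isMIntegralCurve_const hq).isMIntegralCurveOn _
  have := IsMIntegralCurveOn.eqOn_Icc (t₀ := 0) hX h₁ h₂ ⟨min_le_right _ _, le_max_right _ _⟩
    (by simp only [h.map_zero]) ⟨min_le_left _ _, le_max_left _ _⟩
  exact this

end IsFlowOf

end Flow

/-! ### `f` along the orbits -/

section Monotone

variable {E : Type*} [NormedAddCommGroup E] [NormedSpace ℝ E] {H : Type*} [TopologicalSpace H]
  {I : ModelWithCorners ℝ E H} {M : Type u} [TopologicalSpace M] [ChartedSpace H M]
  {X : Π x : M, TangentSpace I x} {θ : ℝ × M → M} {f : M → ℝ}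

namespace IsFlowOf

/-- **`f` is monotone along the orbits** when `X(f) ≥ 0` everywhere (Milnor 1965, proof of
Thm. 3.4: `d f(φ(t))/dt = ξ(f)`; the tree's `Literature.Topology.FourManifolds.monotoneOn_comp_of_isMIntegralCurveOn`). [cite: MilnorHCobordism1965, proof of Thm. 3.4] -/
theorem monotone_apply (h : IsFlowOf I X θ) (hf : MDifferentiable I 𝓘(ℝ, ℝ) f)
    (hXf : ∀ y, 0 ≤ mlineDeriv I f y (X y)) (p : M) : Monotone fun t => f (θ (t, p)) := by
  have hm := monotoneOn_comp_of_isMIntegralCurveOn hf hXf convex_univ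
    ((h.isMIntegralCurve p).isMIntegralCurveOn univ)
  exact fun s t hst => hm (mem_univ s) (mem_univ t) hst

/-- The derivative of `t ↦ f(θ(t, p))` is `X(f)` at the current point. [cite: MilnorHCobordism1965, proof of Thm. 3.4] -/
theorem hasDerivAt_apply (h : IsFlowOf I X θ) (hf : ContMDiff I 𝓘(ℝ, ℝ) ∞ f) (p : M) (t : ℝ) :
    HasDerivAt (fun t => f (θ (t, p))) (mlineDeriv I f (θ (t, p)) (X (θ (t, p)))) t := by
  have h' := ((h.isMIntegralCurve p).isMIntegralCurveOn univ).hasDerivWithinAt_comp (mem_univ t)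
    (hf.mdifferentiableAt (by simp))
  exact hasDerivWithinAt_univ.1 h'

/-- **Strict increase past a time where `X(f) > 0`**: if `X(f) ≥ 0` everywhere and
`X(f)(θ(t₀, p)) > 0`, then `f(θ(t₀, p)) < f(θ(t, p))` for every `t > t₀` (the derivative at
`t₀` is positive, so `f` increases strictly just after `t₀`, and it never decreases). [cite: MilnorHCobordism1965, proof of Thm. 3.4] -/
theorem apply_lt_apply_of_pos (h : IsFlowOf I X θ) (hf : ContMDiff I 𝓘(ℝ, ℝ) ∞ f)
    (hXf : ∀ y, 0 ≤ mlineDeriv I f y (X y)) {p : M} {t₀ t : ℝ}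
    (hpos : 0 < mlineDeriv I f (θ (t₀, p)) (X (θ (t₀, p)))) (ht : t₀ < t) :
    f (θ (t₀, p)) < f (θ (t, p)) := by
  set g : ℝ → ℝ := fun t => f (θ (t, p)) with hg
  have hmono : Monotone g := h.monotone_apply (hf.mdifferentiable (by simp)) hXf p
  have hd : HasDerivAt g (mlineDeriv I f (θ (t₀, p)) (X (θ (t₀, p)))) t₀ := h.hasDerivAt_apply hf p t₀
  -- slopes just after `t₀` are positive
  have hslope : ∀ᶠ s in 𝓝[>] t₀, 0 < slope g t₀ s := by
    have ht' : Tendsto (slope g t₀) (𝓝[>] t₀) (𝓝 (mlineDeriv I f (θ (t₀, p)) (X (θ (t₀, p))))) :=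
      (hasDerivAt_iff_tendsto_slope.1 hd).mono_left (nhdsWithin_mono _ fun s hs => ne_of_gt hs)
    exact ht'.eventually (lt_mem_nhds hpos)
  obtain ⟨s, hs, hst₀, hst⟩ : ∃ s, 0 < slope g t₀ s ∧ t₀ < s ∧ s ≤ t := by
    have hmem : Ioc t₀ t ∈ 𝓝[>] t₀ := Ioc_mem_nhdsGT ht
    obtain ⟨s, hs⟩ := (hslope.and hmem).exists
    exact ⟨s, hs.1, hs.2.1, hs.2.2⟩
  have hgs : g t₀ < g s := by
    have := hs
    rw [slope_def_field] at this
    have hden : 0 < s - t₀ := sub_pos.2 hst₀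
    exact sub_pos.1 ((div_pos_iff_of_pos_right hden).1 this)
  exact lt_of_lt_of_le hgs (hmono hst)

/-- Mirror image: `f(θ(t, p)) < f(θ(t₀, p))` for `t < t₀` when `X(f)(θ(t₀, p)) > 0`. [cite: MilnorHCobordism1965, proof of Thm. 3.4] -/
theorem apply_lt_apply_of_pos' (h : IsFlowOf I X θ) (hf : ContMDiff I 𝓘(ℝ, ℝ) ∞ f)
    (hXf : ∀ y, 0 ≤ mlineDeriv I f y (X y)) {p : M} {t₀ t : ℝ}
    (hpos : 0 < mlineDeriv I f (θ (t₀, p)) (X (θ (t₀, p)))) (ht : t < t₀) :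
    f (θ (t, p)) < f (θ (t₀, p)) := by
  set g : ℝ → ℝ := fun t => f (θ (t, p)) with hg
  have hmono : Monotone g := h.monotone_apply (hf.mdifferentiable (by simp)) hXf p
  have hd : HasDerivAt g (mlineDeriv I f (θ (t₀, p)) (X (θ (t₀, p)))) t₀ := h.hasDerivAt_apply hf p t₀
  have hslope : ∀ᶠ s in 𝓝[<] t₀, 0 < slope g t₀ s := by
    have ht' : Tendsto (slope g t₀) (𝓝[<] t₀) (𝓝 (mlineDeriv I f (θ (t₀, p)) (X (θ (t₀, p))))) :=
      (hasDerivAt_iff_tendsto_slope.1 hd).mono_left (nhdsWithin_mono _ fun s hs => ne_of_lt hs)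
    exact ht'.eventually (lt_mem_nhds hpos)
  obtain ⟨s, hs, hts, hst₀⟩ : ∃ s, 0 < slope g t₀ s ∧ t ≤ s ∧ s < t₀ := by
    have hmem : Ico t t₀ ∈ 𝓝[<] t₀ := Ico_mem_nhdsLT ht
    obtain ⟨s, hs⟩ := (hslope.and hmem).exists
    exact ⟨s, hs.1, hs.2.1, hs.2.2⟩
  have hgs : g s < g t₀ := by
    have := hs
    rw [slope_def_field] at this
    have hden : s - t₀ < 0 := sub_neg.2 hst₀
    have hnum : g s - g t₀ < 0 := by
      rcases div_pos_iff.1 this with h' | h'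
      · exact absurd h'.2 (not_lt.2 hden.le)
      · exact h'.1
    exact sub_neg.1 hnum
  exact lt_of_le_of_lt (hmono hts) hgs

/-! ### The escape set and the ω-limit points of bounded orbits -/

/-- **The escape set is open**: the set of points whose forward orbit climbs strictly above
the level `a` at some time is a union of open sets (continuity of the time-`t` maps). [folklore] -/
theorem isOpen_escapeSet (h : IsFlowOf I X θ) (hf : Continuous f) (a : ℝ) :
    IsOpen {p : M | ∃ t, 0 ≤ t ∧ a < f (θ (t, p))} := by
  have heq : {p : M | ∃ t, 0 ≤ t ∧ a < f (θ (t, p))} =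
      ⋃ t ∈ Ici (0 : ℝ), (fun p => f (θ (t, p))) ⁻¹' Ioi a := by
    ext p
    simp only [mem_setOf_eq, mem_iUnion, mem_preimage, mem_Ioi, mem_Ici, exists_prop]
  rw [heq]
  exact isOpen_biUnion fun t _ => isOpen_Ioi.preimage (hf.comp (h.continuous_apply t))

/-- **ω-limit points of an orbit trapped below a level are critical points** (elementary
Lyapunov argument).  Let `X(f) ≥ 0` everywhere and `X(f) > 0` off the critical set on
`{f ≤ a}`.  If the forward orbit of `p` stays in `{f ≤ a}`, then, on a compact manifold,
`t ↦ θ(t, p)` has a cluster point `q` as `t → ∞`; any such `q` is a critical point of `f`,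
and `f q = sup_t f(θ(t, p))` (so `f(θ(t, p)) ≤ f q ≤ a` for all `t`): were `X(f)(q) > 0`, the
time-`1` map would raise `f` strictly above `f q` near `q`, hence somewhere along the orbit.
[cite: MilnorHCobordism1965, Def. 3.1 and proof of Thm. 3.4] -/
theorem exists_isMCriticalPt_mapClusterPt [CompactSpace M] [T2Space M] (h : IsFlowOf I X θ)
    (hf : ContMDiff I 𝓘(ℝ, ℝ) ∞ f) (hXf : ∀ y, 0 ≤ mlineDeriv I f y (X y)) {a : ℝ}
    (hXpos : ∀ y, f y ≤ a → ¬ IsMCriticalPt I f y → 0 < mlineDeriv I f y (X y)) {p : M}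
    (hp : ∀ t, 0 ≤ t → f (θ (t, p)) ≤ a) :
    ∃ q : M, IsMCriticalPt I f q ∧ (∀ t, f (θ (t, p)) ≤ f q) ∧ f q ≤ a ∧
      MapClusterPt q atTop fun t => θ (t, p) := by
  set g : ℝ → ℝ := fun t => f (θ (t, p)) with hg
  have hmono : Monotone g := h.monotone_apply (hf.mdifferentiable (by simp)) hXf p
  have hga : ∀ t, g t ≤ a := fun t => (hmono (le_max_left t 0)).trans (hp _ (le_max_right t 0))
  have hbdd : BddAbove (range g) := ⟨a, by rintro _ ⟨t, rfl⟩; exact hga t⟩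
  set c : ℝ := ⨆ t, g t with hc
  have hgc : Tendsto g atTop (𝓝 c) := tendsto_atTop_ciSup hmono hbdd
  have hle : ∀ t, g t ≤ c := fun t => le_ciSup hbdd t
  have hca : c ≤ a := ciSup_le hga
  -- a cluster point of the orbit
  obtain ⟨q, hq⟩ : ∃ q, MapClusterPt q atTop fun t => θ (t, p) :=
    exists_clusterPt_of_compactSpace _
  -- `f q = c`
  have hfq : f q = c := by
    have h1 : MapClusterPt (f q) atTop (f ∘ fun t => θ (t, p)) :=
      hq.continuousAt_comp (hf.continuous.continuousAt)
    have h2 : ClusterPt (f q) (𝓝 c) := h1.clusterPt.mono hgc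
    exact eq_of_nhds_neBot h2
  -- `q` is critical
  have hcrit : IsMCriticalPt I f q := by
    by_contra hq'
    have hpos : 0 < mlineDeriv I f (θ (0, q)) (X (θ (0, q))) := by
      rw [h.map_zero]; exact hXpos q (hfq ▸ hca) hq'
    have hlt : f q < f (θ (1, q)) := by
      have := h.apply_lt_apply_of_pos hf hXf hpos one_pos
      rwa [h.map_zero] at this
    -- near `q`, the time-`1` map raises `f` above `f q`
    have hU : ∀ᶠ y in 𝓝 q, f q < f (θ (1, y)) :=
      (hf.continuous.comp (h.continuous_apply 1)).continuousAt.eventually (lt_mem_nhds hlt)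
    obtain ⟨t, ht⟩ := (hq.frequently hU).exists
    have : f (θ (1, θ (t, p))) ≤ f q := by rw [h.map_add, hfq]; exact hle _
    exact absurd ht (not_lt.2 this)
  exact ⟨q, hcrit, fun t => hfq ▸ hle t, hfq ▸ hca, hq⟩

end IsFlowOf

end Monotone

/-! ### Milnor's model near a critical point: sums of squares of coordinates -/

section Model

variable {m : ℕ}

/-- Local notation: `𝔼 m` is the model Euclidean space `EuclideanSpace ℝ (Fin m)`. -/
local notation "𝔼 " m:arg => EuclideanSpace ℝ (Fin m)

/-- `|x⃗|² = u₁² + ⋯ + u_k²`, the sum of squares of the contracting coordinates of Milnor's model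
of index `k`. [cite: MilnorHCobordism1965, Def. 3.1] -/
def sqSumLT (k : ℕ) (u : 𝔼 m) : ℝ :=
  ∑ i ∈ Finset.univ.filter (fun i : Fin m => (i : ℕ) < k), (u i) ^ 2

/-- `|y⃗|² = u_{k+1}² + ⋯ + uₘ²`, the sum of squares of the expanding coordinates of Milnor's
model of index `k`. [cite: MilnorHCobordism1965, Def. 3.1] -/
def sqSumGE (k : ℕ) (u : 𝔼 m) : ℝ :=
  ∑ i ∈ Finset.univ.filter (fun i : Fin m => k ≤ (i : ℕ)), (u i) ^ 2

/-- Milnor's quadratic form is `-|x⃗|² + |y⃗|²`. [cite: MilnorHCobordism1965, Def. 3.1] -/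
theorem milnorQuadratic_eq (k : ℕ) (u : 𝔼 m) :
    milnorQuadratic k u = -sqSumLT k u + sqSumGE k u := rfl

/-- `|x⃗|² ≥ 0`. [folklore] -/
theorem sqSumLT_nonneg (k : ℕ) (u : 𝔼 m) : 0 ≤ sqSumLT k u :=
  Finset.sum_nonneg fun _ _ => sq_nonneg _

/-- `|y⃗|² ≥ 0`. [folklore] -/
theorem sqSumGE_nonneg (k : ℕ) (u : 𝔼 m) : 0 ≤ sqSumGE k u :=
  Finset.sum_nonneg fun _ _ => sq_nonneg _

/-- `|x⃗|² + |y⃗|² = ‖u‖²`. [folklore] -/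
theorem sqSumLT_add_sqSumGE (k : ℕ) (u : 𝔼 m) : sqSumLT k u + sqSumGE k u = ‖u‖ ^ 2 := by
  rw [EuclideanSpace.real_norm_sq_eq, sqSumLT, sqSumGE]
  have h : Finset.univ.filter (fun i : Fin m => k ≤ (i : ℕ)) =
      Finset.univ.filter (fun i : Fin m => ¬ (i : ℕ) < k) := by
    ext i; simp [not_lt]
  rw [h, Finset.sum_filter_add_sum_filter_not]

/-- `|y⃗|² = 0` forces all expanding coordinates to vanish. [folklore] -/
theorem apply_eq_zero_of_sqSumGE_eq_zero {k : ℕ} {u : 𝔼 m} (h : sqSumGE k u = 0) {i : Fin m}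
    (hi : k ≤ (i : ℕ)) : u i = 0 := by
  have h' := (Finset.sum_eq_zero_iff_of_nonneg (fun j _ => sq_nonneg (u j))).1 h i
    (Finset.mem_filter.2 ⟨Finset.mem_univ _, hi⟩)
  exact pow_eq_zero_iff two_ne_zero |>.1 h'

/-- The derivative of a partial sum of squares of coordinates. [folklore] -/
theorem hasFDerivAt_sum_sq (S : Finset (Fin m)) (u : 𝔼 m) :
    HasFDerivAt (fun u : 𝔼 m => ∑ i ∈ S, (u i) ^ 2)
      (∑ i ∈ S, (2 * u i) • (EuclideanSpace.proj (𝕜 := ℝ) i)) u := by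
  apply HasFDerivAt.fun_sum
  intro i _
  have hp : HasFDerivAt (fun u : 𝔼 m => u i) (EuclideanSpace.proj (𝕜 := ℝ) i) u :=
    (EuclideanSpace.proj (𝕜 := ℝ) i).hasFDerivAt
  have := hp.fun_mul hp
  simp only [← pow_two] at this
  refine this.congr_fderiv ?_
  rw [← add_smul, ← two_mul]

/-- Evaluation of the derivative of `|x⃗|²` on Milnor's model field: `-2|x⃗|²`. [cite: MilnorHCobordism1965, Def. 3.1] -/
theorem fderiv_sqSumLT_milnorModelField (k : ℕ) (u : 𝔼 m) :
    (∑ i ∈ Finset.univ.filter (fun i : Fin m => (i : ℕ) < k),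
      (2 * u i) • (EuclideanSpace.proj (𝕜 := ℝ) i)) (milnorModelField k u) = -2 * sqSumLT k u := by
  simp only [FunLike.coe_sum, Finset.sum_apply, FunLike.coe_smul, Pi.smul_apply,
    EuclideanSpace.coe_proj, smul_eq_mul, milnorModelField_apply, sqSumLT, Finset.mul_sum]
  refine Finset.sum_congr rfl fun i hi => ?_
  rw [Finset.mem_filter] at hi
  rw [if_pos hi.2]; ring

/-- Evaluation of the derivative of `|y⃗|²` on Milnor's model field: `2|y⃗|²`. [cite: MilnorHCobordism1965, Def. 3.1] -/
theorem fderiv_sqSumGE_milnorModelField (k : ℕ) (u : 𝔼 m) :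
    (∑ i ∈ Finset.univ.filter (fun i : Fin m => k ≤ (i : ℕ)),
      (2 * u i) • (EuclideanSpace.proj (𝕜 := ℝ) i)) (milnorModelField k u) = 2 * sqSumGE k u := by
  simp only [FunLike.coe_sum, Finset.sum_apply, FunLike.coe_smul, Pi.smul_apply,
    EuclideanSpace.coe_proj, smul_eq_mul, milnorModelField_apply, sqSumGE, Finset.mul_sum]
  refine Finset.sum_congr rfl fun i hi => ?_
  rw [Finset.mem_filter] at hi
  rw [if_neg (not_lt.2 hi.2)]; ring

/-- `|x⃗|²` is continuous. [folklore] -/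
theorem continuous_sqSumLT (k : ℕ) : Continuous (sqSumLT (m := m) k) :=
  continuous_finsetSum _ fun i _ => ((EuclideanSpace.proj (𝕜 := ℝ) i).continuous).pow 2

/-- `|y⃗|²` is continuous. [folklore] -/
theorem continuous_sqSumGE (k : ℕ) : Continuous (sqSumGE (m := m) k) :=
  continuous_finsetSum _ fun i _ => ((EuclideanSpace.proj (𝕜 := ℝ) i).continuous).pow 2

end Model

/-! ### Milnor boxes about critical points and the trap lemma -/

section Trap

variable {m : ℕ} {H : Type*} [TopologicalSpace H] {J : ModelWithCorners ℝ (EuclideanSpace ℝ (Fin m)) H}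
  {M : Type u} [TopologicalSpace M] [ChartedSpace H M]

/-- Local notation: `𝔼 m` is the model Euclidean space `EuclideanSpace ℝ (Fin m)`. -/
local notation "𝔼 " m:arg => EuclideanSpace ℝ (Fin m)

variable (J) in
/-- **A Milnor box about the critical point `q`** for the function `f` and the vector field
`X`: a chart `φ` of the `C^∞` maximal atlas about `q`, an index `k` and a size `ε > 0` such
that the closed ball of radius `3ε` about `φ̂ q` lies in the chart target (`φ̂ = φ.extend J`),
and on `φ.source` Milnor's normal form holds, `f = f q - |x⃗|² + |y⃗|²` and `dφ̂(X) = (-x⃗, y⃗)`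
in the centred coordinates `u = (x⃗, y⃗) = φ̂ - φ̂ q` (Milnor 1965, Def. 3.1 (2)). [cite: MilnorHCobordism1965, Def. 3.1] -/
structure MilnorBox (f : M → ℝ) (X : Π x : M, TangentSpace J x) (q : M) where
  /-- The chart. -/
  chart : OpenPartialHomeomorph M H
  /-- The index of the normal form. -/
  k : ℕ
  /-- The size of the box. -/
  ε : ℝ
  mem_maximalAtlas : chart ∈ IsManifold.maximalAtlas J ∞ M
  mem_source : q ∈ chart.source
  eps_pos : 0 < ε
  closedBall_subset : closedBall (chart.extend J q) (3 * ε) ⊆ (chart.extend J).target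
  apply_eq : ∀ q' ∈ chart.source,
    f q' = f q + milnorQuadratic k (chart.extend J q' - chart.extend J q)
  mfderiv_eq : ∀ q' ∈ chart.source, mfderiv J 𝓘(ℝ, 𝔼 m) (chart.extend J) q' (X q') =
    milnorModelField k (chart.extend J q' - chart.extend J q)

namespace MilnorBox

variable {f : M → ℝ} {X : Π x : M, TangentSpace J x} {q : M} (D : MilnorBox J f X q)

/-- The centred coordinates `u = φ̂ q' - φ̂ q`. [cite: MilnorHCobordism1965, Def. 3.1] -/
def coord (q' : M) : 𝔼 m := D.chart.extend J q' - D.chart.extend J q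

/-- The coordinates of the centre vanish. [folklore] -/
@[simp] theorem coord_self : D.coord q = 0 := sub_self _

/-- **The box** `{|x⃗|² < ε², |y⃗|² < 4ε²}` (inside the chart domain). [cite: MilnorHCobordism1965, proof of Thm. 3.13] -/
def box : Set M :=
  {q' | q' ∈ D.chart.source ∧ sqSumLT D.k (D.coord q') < D.ε ^ 2 ∧ sqSumGE D.k (D.coord q') < 4 * D.ε ^ 2}

/-- **The local stable disc** `{y⃗ = 0, |x⃗|² < ε²}` of `q`, the part of the stable manifold
of the model flow inside the box (Milnor 1965, proof of Thm. 3.13: the trajectories through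
the points `(x⃗, 0)` converge to the critical point). [cite: MilnorHCobordism1965, proof of Thm. 3.13] -/
def stableDisc : Set M :=
  (fun v : 𝔼 m => (D.chart.extend J).symm (D.chart.extend J q + v)) ''
    {v | sqSumGE D.k v = 0 ∧ sqSumLT D.k v < D.ε ^ 2}

/-- The centre lies in its box. [folklore] -/
theorem mem_box_self : q ∈ D.box := by
  refine ⟨D.mem_source, ?_, ?_⟩ <;> simp [sqSumLT, sqSumGE, D.eps_pos]

/-- The coordinates are continuous on the chart domain. [folklore] -/
theorem continuousOn_coord : ContinuousOn D.coord D.chart.source := by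
  have h := D.chart.continuousOn_extend (I := J)
  rw [D.chart.extend_source] at h
  exact h.sub continuousOn_const

/-- The box is open. [folklore] -/
theorem isOpen_box : IsOpen D.box := by
  have h1 : IsOpen (D.chart.source ∩ D.coord ⁻¹' (sqSumLT D.k ⁻¹' Iio (D.ε ^ 2) ∩
      sqSumGE D.k ⁻¹' Iio (4 * D.ε ^ 2))) :=
    D.continuousOn_coord.isOpen_inter_preimage D.chart.open_source
      ((isOpen_Iio.preimage (continuous_sqSumLT _)).inter (isOpen_Iio.preimage (continuous_sqSumGE _)))
  have heq : D.box = D.chart.source ∩ D.coord ⁻¹' (sqSumLT D.k ⁻¹' Iio (D.ε ^ 2) ∩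
      sqSumGE D.k ⁻¹' Iio (4 * D.ε ^ 2)) := by
    ext q'
    simp only [MilnorBox.box, mem_setOf_eq, mem_inter_iff, mem_preimage, mem_Iio]
  rw [heq]; exact h1

/-- A vector with `|x⃗|² ≤ ε²` and `|y⃗|² ≤ 4ε²` has norm at most `3ε`. [folklore] -/
theorem norm_le_of_sq_le {v : 𝔼 m} (h₁ : sqSumLT D.k v ≤ D.ε ^ 2) (h₂ : sqSumGE D.k v ≤ 4 * D.ε ^ 2) :
    ‖v‖ ≤ 3 * D.ε := by
  have h : ‖v‖ ^ 2 ≤ (3 * D.ε) ^ 2 := by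
    rw [← sqSumLT_add_sqSumGE D.k v]; nlinarith [D.eps_pos]
  exact (pow_le_pow_iff_left₀ (norm_nonneg _) (by linarith [D.eps_pos]) two_ne_zero).1 h

/-- Points `φ̂ q + v` with `|x⃗(v)|² ≤ ε²`, `|y⃗(v)|² ≤ 4ε²` lie in the chart target. [folklore] -/
theorem add_mem_target {v : 𝔼 m} (h₁ : sqSumLT D.k v ≤ D.ε ^ 2) (h₂ : sqSumGE D.k v ≤ 4 * D.ε ^ 2) :
    D.chart.extend J q + v ∈ (D.chart.extend J).target :=
  D.closedBall_subset (by simpa [dist_eq_norm] using D.norm_le_of_sq_le h₁ h₂)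

/-- The chart inverse recovers a point of the chart domain from its coordinates. [folklore] -/
theorem symm_add_coord {q' : M} (hq' : q' ∈ D.chart.source) :
    (D.chart.extend J).symm (D.chart.extend J q + D.coord q') = q' := by
  rw [coord, add_sub_cancel]
  exact D.chart.extend_left_inv (I := J) hq'

/-- The stable disc lies in the box. [folklore] -/
theorem stableDisc_subset_box : D.stableDisc ⊆ D.box := by
  rintro _ ⟨v, ⟨hv0, hv⟩, rfl⟩
  have ht : D.chart.extend J q + v ∈ (D.chart.extend J).target :=
    D.add_mem_target hv.le (by rw [hv0]; positivity)
  have hsrc : (D.chart.extend J).symm (D.chart.extend J q + v) ∈ D.chart.source := by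
    rw [← D.chart.extend_source (I := J)]; exact (D.chart.extend J).map_target ht
  have hc : D.coord ((D.chart.extend J).symm (D.chart.extend J q + v)) = v := by
    rw [coord, (D.chart.extend J).right_inv ht, add_sub_cancel_left]
  refine ⟨hsrc, ?_, ?_⟩
  · rw [hc]; exact hv
  · rw [hc, hv0]; have := D.eps_pos; positivity

end MilnorBox

variable {f : M → ℝ} {X : Π x : M, TangentSpace J x} {θ : ℝ × M → M}

set_option backward.isDefEq.respectTransparency false in
/-- **The coordinates of an orbit solve Milnor's model equation**: while `θ(s, p)` is in the
chart domain, `d/ds φ̂(θ(s, p)) = dφ̂(X) = (-x⃗, y⃗)`. [cite: MilnorHCobordism1965, Def. 3.1 and proof of Thm. 3.13] -/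
theorem IsFlowOf.hasDerivAt_coord (h : IsFlowOf J X θ) {q : M} (D : MilnorBox J f X q) {p : M}
    {s : ℝ} (hs : θ (s, p) ∈ D.chart.source) :
    HasDerivAt (fun t => D.coord (θ (t, p))) (milnorModelField D.k (D.coord (θ (s, p)))) s := by
  have hγ : HasMFDerivAt 𝓘(ℝ, ℝ) J (fun t => θ (t, p)) s
      ((1 : ℝ →L[ℝ] ℝ).smulRight (X (θ (s, p)))) := h.isMIntegralCurve p s
  have hφ : HasMFDerivAt J 𝓘(ℝ, 𝔼 m) (D.chart.extend J) (θ (s, p))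
      (mfderiv J 𝓘(ℝ, 𝔼 m) (D.chart.extend J) (θ (s, p))) :=
    (mdifferentiableAt_extend_of_mem_maximalAtlas D.mem_maximalAtlas hs).hasMFDerivAt
  have h1 : HasMFDerivAt 𝓘(ℝ, ℝ) 𝓘(ℝ, 𝔼 m) (D.chart.extend J ∘ fun t => θ (t, p)) s
      ((mfderiv J 𝓘(ℝ, 𝔼 m) (D.chart.extend J) (θ (s, p))).comp
        ((1 : ℝ →L[ℝ] ℝ).smulRight (X (θ (s, p))))) := hφ.comp s hγ
  have h2 : HasFDerivAt (D.chart.extend J ∘ fun t => θ (t, p))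
      ((mfderiv J 𝓘(ℝ, 𝔼 m) (D.chart.extend J) (θ (s, p))).comp
        ((1 : ℝ →L[ℝ] ℝ).smulRight (X (θ (s, p))))) s :=
    hasMFDerivAt_iff_hasFDerivAt.1 h1
  have h3 : ((mfderiv J 𝓘(ℝ, 𝔼 m) (D.chart.extend J) (θ (s, p))).comp
        ((1 : ℝ →L[ℝ] ℝ).smulRight (X (θ (s, p)))) : ℝ →L[ℝ] 𝔼 m) =
      (1 : ℝ →L[ℝ] ℝ).smulRight (milnorModelField D.k (D.coord (θ (s, p)))) := by
    apply ContinuousLinearMap.ext_ring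
    show (mfderiv J 𝓘(ℝ, 𝔼 m) (D.chart.extend J) (θ (s, p))) (((1 : ℝ →L[ℝ] ℝ) (1 : ℝ)) • X (θ (s, p))) =
      ((1 : ℝ →L[ℝ] ℝ) (1 : ℝ)) • milnorModelField D.k (D.coord (θ (s, p)))
    rw [map_smul, D.mfderiv_eq _ hs]
    rfl
  have h4 : HasDerivAt (D.chart.extend J ∘ fun t => θ (t, p))
      (milnorModelField D.k (D.coord (θ (s, p)))) s :=
    hasDerivAt_iff_hasFDerivAt.2 (h2.congr_fderiv h3)
  exact h4.sub_const _

/-- Along an orbit in the chart domain, `d|x⃗|²/ds = -2|x⃗|²`. [cite: MilnorHCobordism1965, proof of Thm. 3.13] -/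
theorem IsFlowOf.hasDerivAt_sqSumLT (h : IsFlowOf J X θ) {q : M} (D : MilnorBox J f X q) {p : M}
    {s : ℝ} (hs : θ (s, p) ∈ D.chart.source) :
    HasDerivAt (fun t => sqSumLT D.k (D.coord (θ (t, p))))
      (-2 * sqSumLT D.k (D.coord (θ (s, p)))) s := by
  have h1 := (hasFDerivAt_sum_sq (Finset.univ.filter (fun i : Fin m => (i : ℕ) < D.k))
    (D.coord (θ (s, p)))).comp_hasDerivAt s (h.hasDerivAt_coord D hs)
  rw [fderiv_sqSumLT_milnorModelField] at h1
  exact h1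

/-- Along an orbit in the chart domain, `d|y⃗|²/ds = 2|y⃗|²`. [cite: MilnorHCobordism1965, proof of Thm. 3.13] -/
theorem IsFlowOf.hasDerivAt_sqSumGE (h : IsFlowOf J X θ) {q : M} (D : MilnorBox J f X q) {p : M}
    {s : ℝ} (hs : θ (s, p) ∈ D.chart.source) :
    HasDerivAt (fun t => sqSumGE D.k (D.coord (θ (t, p))))
      (2 * sqSumGE D.k (D.coord (θ (s, p)))) s := by
  have h1 := (hasFDerivAt_sum_sq (Finset.univ.filter (fun i : Fin m => D.k ≤ (i : ℕ)))
    (D.coord (θ (s, p)))).comp_hasDerivAt s (h.hasDerivAt_coord D hs)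
  rw [fderiv_sqSumGE_milnorModelField] at h1
  exact h1

/-- **The trap lemma** (Milnor's model trajectories `(e^{-t} x⃗, e^{t} y⃗)`, proof of Thm. 3.13).
Let `D` be a Milnor box about the critical point `q` for `f` and `X`, `θ` a global flow of
`X`.  If `θ(t₁, p)` lies in the box `{|x⃗|² < ε², |y⃗|² < 4ε²}` and `f(θ(t, p)) ≤ f q` for all
`t ≥ t₁`, then `y⃗(θ(t₁, p)) = 0`.  For if `|y⃗₁|² > 0`: inside the box `d|y⃗|²/dt = 2|y⃗|² ≥ 2|y⃗₁|²`
and `d|x⃗|²/dt ≤ 0`, so the orbit must leave the box before time `t₁ + 2ε²/|y⃗₁|²`; at the first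
exit time `t₂` the point is still in the chart domain (the closed box is compact) with
`|x⃗|² ≤ |x⃗₁|² < ε²`, hence `|y⃗|² = 4ε²` and `f = f q - |x⃗|² + |y⃗|² > f q`, a contradiction. [cite: MilnorHCobordism1965, proof of Thm. 3.13 (model trajectories)] -/
theorem MilnorBox.sqSumGE_coord_eq_zero [T2Space M] {q : M} (D : MilnorBox J f X q)
    (h : IsFlowOf J X θ) {p : M} {t₁ : ℝ} (hmem : θ (t₁, p) ∈ D.box)
    (hle : ∀ t, t₁ ≤ t → f (θ (t, p)) ≤ f q) : sqSumGE D.k (D.coord (θ (t₁, p))) = 0 := by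
  -- notation
  set A : ℝ → ℝ := fun t => sqSumLT D.k (D.coord (θ (t, p))) with hA
  set B : ℝ → ℝ := fun t => sqSumGE D.k (D.coord (θ (t, p))) with hB
  have hε := D.eps_pos
  by_contra hB₁
  have hB₁pos : 0 < B t₁ := lt_of_le_of_ne (sqSumGE_nonneg _ _) (Ne.symm hB₁)
  -- continuity and derivatives where the orbit is in the chart domain
  have hcontA : ∀ s, θ (s, p) ∈ D.chart.source → ContinuousAt A s := fun s hs =>
    (h.hasDerivAt_sqSumLT D hs).continuousAt
  have hcontB : ∀ s, θ (s, p) ∈ D.chart.source → ContinuousAt B s := fun s hs =>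
    (h.hasDerivAt_sqSumGE D hs).continuousAt
  -- the orbit cannot stay in the box on `[t₁, s*]`, `s* = t₁ + 2ε²/B₁`
  set sstar : ℝ := t₁ + 2 * D.ε ^ 2 / B t₁ with hsstar
  have hsstar_gt : t₁ < sstar := by
    rw [hsstar]; have : 0 < 2 * D.ε ^ 2 / B t₁ := by positivity
    linarith
  have hexit : ∃ s ∈ Icc t₁ sstar, θ (s, p) ∉ D.box := by
    by_contra hall
    push Not at hall
    have hsrc : ∀ s ∈ Icc t₁ sstar, θ (s, p) ∈ D.chart.source := fun s hs => (hall s hs).1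
    have hBcont : ContinuousOn B (Icc t₁ sstar) := fun s hs => (hcontB s (hsrc s hs)).continuousWithinAt
    have hBderiv : ∀ s ∈ interior (Icc t₁ sstar), HasDerivWithinAt B (2 * B s) (interior (Icc t₁ sstar)) s :=
      fun s hs => (h.hasDerivAt_sqSumGE D (hsrc s (interior_subset hs))).hasDerivWithinAt
    -- `B` is monotone on the interval, hence `≥ B t₁`
    have hBmono : MonotoneOn B (Icc t₁ sstar) :=
      monotoneOn_of_hasDerivWithinAt_nonneg (f' := fun s => 2 * B s) (convex_Icc _ _) hBcont hBderiv
        fun s _ => mul_nonneg zero_le_two (sqSumGE_nonneg D.k (D.coord (θ (s, p))))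
    have hBge : ∀ s ∈ Icc t₁ sstar, B t₁ ≤ B s := fun s hs =>
      hBmono (left_mem_Icc.2 hsstar_gt.le) hs hs.1
    -- growth at rate `≥ 2 B t₁`
    have hgrowth := (convex_Icc t₁ sstar).mul_sub_le_image_sub_of_le_deriv hBcont
      (fun s hs => (hBderiv s hs).differentiableWithinAt.differentiableAt
        (isOpen_interior.mem_nhds hs) |>.differentiableWithinAt)
      (C := 2 * B t₁) (fun s hs => by
        rw [(h.hasDerivAt_sqSumGE D (hsrc s (interior_subset hs))).deriv]
        have := hBge s (interior_subset hs); simp only [hB] at this ⊢; linarith)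
      t₁ (left_mem_Icc.2 hsstar_gt.le) sstar (right_mem_Icc.2 hsstar_gt.le) hsstar_gt.le
    have hcalc : 2 * B t₁ * (sstar - t₁) = 4 * D.ε ^ 2 := by
      rw [hsstar]; field_simp; ring
    rw [hcalc] at hgrowth
    have hlt : B sstar < 4 * D.ε ^ 2 := (hall sstar (right_mem_Icc.2 hsstar_gt.le)).2.2
    linarith [hB₁pos.le]
  -- the first exit time
  set Tset : Set ℝ := {s | s ∈ Icc t₁ sstar ∧ θ (s, p) ∉ D.box} with hTset
  have hTne : Tset.Nonempty := by
    obtain ⟨s, hs, hs'⟩ := hexit; exact ⟨s, hs, hs'⟩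
  have hTclosed : IsClosed Tset := by
    have h1 : IsClosed ((fun s => θ (s, p)) ⁻¹' D.boxᶜ) :=
      D.isOpen_box.isClosed_compl.preimage (h.continuous_orbit p)
    exact isClosed_Icc.inter h1
  have hTbdd : BddBelow Tset := ⟨t₁, fun s hs => hs.1.1⟩
  set t₂ : ℝ := sInf Tset with ht₂
  have ht₂mem : t₂ ∈ Tset := hTclosed.csInf_mem hTne hTbdd
  have ht₁₂ : t₁ ≤ t₂ := ht₂mem.1.1
  have hin : ∀ s ∈ Ico t₁ t₂, θ (s, p) ∈ D.box := fun s hs => by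
    by_contra hs'
    have hsT : s ∈ Tset := ⟨⟨hs.1, le_trans hs.2.le ht₂mem.1.2⟩, hs'⟩
    exact absurd (csInf_le hTbdd hsT) (not_le.2 hs.2)
  have ht₁₂' : t₁ < t₂ := lt_of_le_of_ne ht₁₂ fun heq => ht₂mem.2 (heq ▸ hmem)
  -- the closed box is compact and contains the orbit on `[t₁, t₂)`, hence at `t₂`
  set Kc : Set (𝔼 m) := {v | sqSumLT D.k v ≤ D.ε ^ 2 ∧ sqSumGE D.k v ≤ 4 * D.ε ^ 2} with hKc
  set ψ : 𝔼 m → M := fun v => (D.chart.extend J).symm (D.chart.extend J q + v) with hψ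
  have hKc_cpt : IsCompact Kc := by
    have hclosed : IsClosed Kc :=
      (isClosed_le (continuous_sqSumLT _) continuous_const).inter
        (isClosed_le (continuous_sqSumGE _) continuous_const)
    refine Metric.isCompact_of_isClosed_isBounded hclosed ?_
    refine (isBounded_closedBall (x := (0 : 𝔼 m)) (r := 3 * D.ε)).subset fun v hv => ?_
    simpa using D.norm_le_of_sq_le hv.1 hv.2
  have hψ_cont : ContinuousOn ψ Kc := by
    refine (D.chart.continuousOn_extend_symm (I := J)).comp (continuousOn_const.add continuousOn_id)
      fun v hv => ?_
    exact D.add_mem_target hv.1 hv.2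
  have hK_cpt : IsCompact (ψ '' Kc) := hKc_cpt.image_of_continuousOn hψ_cont
  have hK_src : ψ '' Kc ⊆ D.chart.source := by
    rintro _ ⟨v, hv, rfl⟩
    rw [← D.chart.extend_source (I := J)]
    exact (D.chart.extend J).map_target (D.add_mem_target hv.1 hv.2)
  have horb_K : ∀ s ∈ Ico t₁ t₂, θ (s, p) ∈ ψ '' Kc := fun s hs => by
    obtain ⟨hsrc, h1, h2⟩ := hin s hs
    exact ⟨D.coord (θ (s, p)), ⟨h1.le, h2.le⟩, D.symm_add_coord hsrc⟩
  have ht₂K : θ (t₂, p) ∈ ψ '' Kc := by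
    have htend : Tendsto (fun s => θ (s, p)) (𝓝[<] t₂) (𝓝 (θ (t₂, p))) :=
      ((h.continuous_orbit p).continuousAt (x := t₂)).tendsto.mono_left nhdsWithin_le_nhds
    refine hK_cpt.isClosed.mem_of_tendsto htend ?_
    have hmem' : Ico t₁ t₂ ∈ 𝓝[<] t₂ := Ico_mem_nhdsLT ht₁₂'
    exact mem_of_superset hmem' fun s hs => horb_K s hs
  have ht₂src : θ (t₂, p) ∈ D.chart.source := hK_src ht₂K
  have ht₂coord : D.coord (θ (t₂, p)) ∈ Kc := by
    obtain ⟨v, hv, hvq⟩ := ht₂K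
    have : D.coord (θ (t₂, p)) = v := by
      rw [← hvq, MilnorBox.coord, (D.chart.extend J).right_inv (D.add_mem_target hv.1 hv.2),
        add_sub_cancel_left]
    rw [this]; exact hv
  -- `A` does not increase on `[t₁, t₂]`
  have hsrc₂ : ∀ s ∈ Icc t₁ t₂, θ (s, p) ∈ D.chart.source := fun s hs => by
    rcases eq_or_lt_of_le hs.2 with h' | h'
    · rw [h']; exact ht₂src
    · exact (hin s ⟨hs.1, h'⟩).1
  have hAanti : AntitoneOn A (Icc t₁ t₂) :=
    antitoneOn_of_hasDerivWithinAt_nonpos (f' := fun s => -2 * A s) (convex_Icc _ _)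
      (fun s hs => (hcontA s (hsrc₂ s hs)).continuousWithinAt)
      (fun s hs => (h.hasDerivAt_sqSumLT D (hsrc₂ s (interior_subset hs))).hasDerivWithinAt)
      fun s _ => by
        have h0 : 0 ≤ A s := sqSumLT_nonneg D.k (D.coord (θ (s, p)))
        show -2 * A s ≤ 0
        linarith
  have hA₂ : A t₂ < D.ε ^ 2 :=
    lt_of_le_of_lt (hAanti (left_mem_Icc.2 ht₁₂) (right_mem_Icc.2 ht₁₂) ht₁₂) hmem.2.1
  -- at `t₂` the orbit is out of the box: `|y⃗|² = 4ε²`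
  have hB₂ : 4 * D.ε ^ 2 ≤ B t₂ := by
    by_contra hlt
    exact ht₂mem.2 ⟨ht₂src, hA₂, not_le.1 hlt⟩
  -- so `f > f q` there
  have hf₂ : f q < f (θ (t₂, p)) := by
    rw [D.apply_eq _ ht₂src, milnorQuadratic_eq]
    change f q < f q + (-A t₂ + B t₂)
    nlinarith
  exact absurd (hle t₂ ht₁₂) (not_le.2 hf₂)

/-- **Consequence: trapped points of the box lie on the stable disc** `{y⃗ = 0, |x⃗|² < ε²}`. [cite: MilnorHCobordism1965, proof of Thm. 3.13 (model trajectories)] -/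
theorem MilnorBox.mem_stableDisc [T2Space M] {q : M} (D : MilnorBox J f X q)
    (h : IsFlowOf J X θ) {p : M} {t₁ : ℝ} (hmem : θ (t₁, p) ∈ D.box)
    (hle : ∀ t, t₁ ≤ t → f (θ (t, p)) ≤ f q) : θ (t₁, p) ∈ D.stableDisc :=
  ⟨D.coord (θ (t₁, p)), ⟨D.sqSumGE_coord_eq_zero h hmem hle, hmem.2.1⟩, D.symm_add_coord hmem.1⟩

/-- **Points whose forward orbit stays below the level `a` come from the stable discs.**  On
a compact manifold, let `θ` be a global flow of `X` with `X(f) ≥ 0`, `X(f) > 0` off the critical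
set on `{f ≤ a}`, and fix Milnor boxes `D q` about the critical points `q` with `f q ≤ a`.  If
`f(θ(t, p)) ≤ a` for all `t ≥ 0`, then `θ(t₁, p)` lies on the stable disc of some critical point
`q` (`f q ≤ a`) for some `t₁ ≥ 0`; that is, `p = θ(-t₁, d)` with `d` on a stable disc
(the orbit accumulates at a critical point `q` with `f ≤ f q` along it, enters the box of `q`,
and the trap lemma applies). [cite: MilnorHCobordism1965, Def. 3.1 and proof of Thm. 3.13] -/
theorem IsFlowOf.exists_mem_stableDisc [CompactSpace M] [T2Space M] (h : IsFlowOf J X θ)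
    (hf : ContMDiff J 𝓘(ℝ, ℝ) ∞ f) (hXf : ∀ y, 0 ≤ mlineDeriv J f y (X y)) {a : ℝ}
    (hXpos : ∀ y, f y ≤ a → ¬ IsMCriticalPt J f y → 0 < mlineDeriv J f y (X y))
    (D : ∀ q : M, IsMCriticalPt J f q → f q ≤ a → MilnorBox J f X q) {p : M}
    (hp : ∀ t, 0 ≤ t → f (θ (t, p)) ≤ a) :
    ∃ (q : M) (hq : IsMCriticalPt J f q) (hqa : f q ≤ a) (t₁ : ℝ), 0 ≤ t₁ ∧
      θ (t₁, p) ∈ (D q hq hqa).stableDisc := by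
  obtain ⟨q, hq, hle, hqa, hcl⟩ := h.exists_isMCriticalPt_mapClusterPt hf hXf hXpos hp
  have hfreq : ∃ᶠ t in atTop, θ (t, p) ∈ (D q hq hqa).box :=
    hcl.frequently ((D q hq hqa).isOpen_box.mem_nhds (D q hq hqa).mem_box_self)
  obtain ⟨t₁, ht₁, hmem⟩ := frequently_atTop.1 hfreq 0
  exact ⟨q, hq, hqa, t₁, ht₁, (D q hq hqa).mem_stableDisc h hmem fun t _ => hle t⟩

end Trap

end Literature.Topology.FourManifolds
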